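/-
Copyright: statement-level skeleton of a published paper (lit-balaban cell, Phase-2 proof seat p20 gen 7). No proof claims
beyond what the kernel checks below.
-/
import Literature.MathematicalPhysics.QuantumFieldTheory.Balaban1983to89.B3CxiTorusSecondDifferenceBound
import Literature.MathematicalPhysics.QuantumFieldTheory.Balaban1983to89.B3Eq324Torus

/-!
# B3 — T. Bałaban, *(Higgs)₂,₃ quantum fields in a finite volume. III. Renormalization*, CMP **88** (1983) 411–445
[Balaban1983Higgs3], (2.10) p. 426 / p. 437 / (3.26) p. 440: the second-order derivative kernel of the free torus propagator
(∂^ξ_{μ′}C^ξ_T∂^{ξ*}_μ)(x, x′) AT ALL SITES — the profile B·(ξ·max(1,|x−x′|_∞))^{−3}e^{−½ξ|x−x′|_∞} including the diagonal x′ = x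

statement-level skeleton of published theorems with citation tags; proofs where landed; nothing here is a claim about
the Yang–Mills mass gap

PDF held: `paper:balaban1983-higgs-2-3-quantum-fields-finite-volume` (journal page = PDF page + 410), p. 426 [PDF 16], p. 437 [PDF 27],
p. 440 [PDF 30].
WHAT IS REPRODUCED: a rider to this seat's `B3CxiTorusSecondDifferenceBound` (rows **B3.Eq2.10** / **B3.Eq3.25-3.32** of
`HOME/lit-balaban-r15/ROWS-B3.md`, fold owner r15): the (2.10)-type bound *"O(1)(L^jη)^{−1}d(x,x′)^{−1}e^{−δ₀d(x,x′)} … for each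
differentiation ∂^η … an additional factor (L^jη)^{−1}d(x,x′)^{−1}"* with the REGULARISED distance d(x,x′) = ξ·max(1,|x−x′|_∞) of the
(1.3)/(2.10) convention (the propagators are finite on the lattice diagonal), in the ALL-SITES shape used by the (3.16)/(3.26) cross-term
files of seat p39 (`B3ZeroTorusKernelProfiles.G0xi_mixed_bound`, `B3Eq323CrossTermsZeroTorus.abs_CxiT_profile`,
`B3Bound316ZeroTorus.abs_d1Kernel_CxiT_profile`): for d = 3, 0 < ξ ≤ 1, ξN ≥ 1 and ALL x, x′, μ′, μ,
**`abs_d2Kernel_CxiT_profile`: |(∂^ξ_{μ′}C^ξ_T∂^{ξ*}_μ)(x,x′)| ≤ (205875000 + 2(torusConst + 472501))·((ξ·max(1,supDist x x′))³)⁻¹·e^{−½ξ·supDist x x′}**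
— off the diagonal this seat's `abs_d2Kernel_CxiT_le'`, on it the four values of C^ξ_T entering the second difference quotient lie in
[0, (torusConst + 472501)ξ^{−1}] (p39's `B3Eq324Torus.CxiT_le_all`), so |(∂∂C^ξ_T)(x,x)| ≤ 2(torusConst + 472501)ξ^{−3}
(`abs_d2Kernel_CxiT_diag_le`); the diagonal `dKernel` form `abs_dKernel_CxiT_profile`.  Mathlib + the cited tree files only;
theorems only, no new definitions, no named facts; standard axioms.  Unit `lit-balaban-p20-g7` (Phase-2 proof seat p20, gen 7),
HOME `run/shared/lean/pub/lit-balaban/`, 2026-08-21.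
-/

open scoped BigOperators
open Real Set

namespace Literature.MathematicalPhysics.QuantumFieldTheory.Balaban1983to89.B3CxiTorusSecondDifferenceProfile

open B3Sect3VectorSelfEnergy B3CxiTorusBound B3CxiTorusSecondDifferenceBound B3Sect3ScalarSelfEnergy B3TorusRadialSums
  LatticeFieldCalculus B3Eq324Torus

noncomputable section

variable {P : Params} {j : ℕ}

/-- kernel: off the diagonal the regularised radius is the torus distance, max(1, |x − x′|) = |x − x′| for x′ ≠ x. [folklore] -/
private theorem max_one_supDist_of_ne {y z : Site P j} (hne : z ≠ y) : max (1 : ℝ) (supDist y z : ℝ) = (supDist y z : ℝ) := by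
  have h0 : supDist y z ≠ 0 := fun h => hne (((supDist_eq_zero_iff y z).mp h).symm)
  have h1 : (1 : ℝ) ≤ (supDist y z : ℝ) := by exact_mod_cast Nat.one_le_iff_ne_zero.mpr h0
  exact max_eq_right h1

/-- kernel: on the diagonal the regularised radius is 1. [folklore] -/
private theorem max_one_supDist_self (y : Site P j) : max (1 : ℝ) (supDist y y : ℝ) = 1 := by
  rw [(supDist_eq_zero_iff y y).mpr rfl, Nat.cast_zero]
  exact max_eq_left zero_le_one

/-- **The second-order kernel ON the diagonal**: |(∂^ξ_{μ′}C^ξ_T∂^{ξ*}_μ)(x,x)| ≤ 2(torusConst + 472501)·ξ^{−3} (d = 3, 0 < ξ ≤ 1,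
ξN ≥ 1; the four values of C^ξ_T in ξ^{−2}[C(x+e_{μ′},x+e_μ) − C(x+e_{μ′},x) − C(x,x+e_μ) + C(x,x)] lie in [0, (torusConst + 472501)ξ^{−1}]).
[cite: Balaban1983Higgs3, (2.10) p.426] -/
theorem abs_d2Kernel_CxiT_diag_le (hd : P.d = 3) {ξ : ℝ} (hξ : 0 < ξ) (hξ1 : ξ ≤ 1) (hN : 1 ≤ ξ * (P.sitesPerDir j : ℝ))
    (μ' μ : Fin P.d) (x : Site P j) :
    |d2Kernel ξ⁻¹ μ' μ (CxiT ξ) x x| ≤ 2 * (torusConst + 472501) * (ξ ^ 3)⁻¹ := by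
  have ha := CxiT_le_all hd hξ hξ1 hN (x.shift μ') (x.shift μ)
  have hb := CxiT_le_all hd hξ hξ1 hN (x.shift μ') x
  have hc := CxiT_le_all hd hξ hξ1 hN x (x.shift μ)
  have hd' := CxiT_le_all hd hξ hξ1 hN x x
  have ha0 := CxiT_nonneg hξ (x.shift μ') (x.shift μ)
  have hb0 := CxiT_nonneg hξ (x.shift μ') x
  have hc0 := CxiT_nonneg hξ x (x.shift μ)
  have hd0 := CxiT_nonneg hξ x x
  have hdiff : |CxiT ξ (x.shift μ') (x.shift μ) - CxiT ξ (x.shift μ') x - CxiT ξ x (x.shift μ) + CxiT ξ x x| ≤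
      2 * ((torusConst + 472501) * ξ⁻¹) := by
    rw [abs_le]; constructor <;> linarith
  unfold d2Kernel
  rw [abs_mul, abs_of_pos (by positivity)]
  calc ξ⁻¹ ^ 2 * |CxiT ξ (x.shift μ') (x.shift μ) - CxiT ξ (x.shift μ') x - CxiT ξ x (x.shift μ) + CxiT ξ x x|
      ≤ ξ⁻¹ ^ 2 * (2 * ((torusConst + 472501) * ξ⁻¹)) := mul_le_mul_of_nonneg_left hdiff (by positivity)
    _ = 2 * (torusConst + 472501) * (ξ ^ 3)⁻¹ := by rw [← inv_pow]; ring

/-- **[Balaban1983Higgs3] (2.10) at second order for the free torus propagator, AT ALL SITES** (d = 3, 0 < ξ ≤ 1, ξN ≥ 1, all x, x′,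
μ′, μ): |(∂^ξ_{μ′}C^ξ_T∂^{ξ*}_μ)(x,x′)| ≤ (205875000 + 2(torusConst + 472501))·((ξ·max(1, supDist x x′))³)⁻¹·e^{−½ξ·supDist x x′} — off the
diagonal `abs_d2Kernel_CxiT_le'`, on it `abs_d2Kernel_CxiT_diag_le`. [cite: Balaban1983Higgs3, (2.10) p.426] -/
theorem abs_d2Kernel_CxiT_profile (hd : P.d = 3) {ξ : ℝ} (hξ : 0 < ξ) (hξ1 : ξ ≤ 1) (hN : 1 ≤ ξ * (P.sitesPerDir j : ℝ))
    (μ' μ : Fin P.d) (x x' : Site P j) :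
    |d2Kernel ξ⁻¹ μ' μ (CxiT ξ) x x'| ≤ (205875000 + 2 * (torusConst + 472501)) *
      (((ξ * max (1 : ℝ) (supDist x x' : ℝ)) ^ 3)⁻¹ * Real.exp (-(1 / 2 * (ξ * (supDist x x' : ℝ))))) := by
  have hT := torusConst_nonneg
  by_cases hne : x' = x
  · subst hne
    rw [max_one_supDist_self, (supDist_eq_zero_iff x' x').mpr rfl, Nat.cast_zero, mul_zero, mul_zero, neg_zero,
      Real.exp_zero, mul_one, mul_one]
    have h := abs_d2Kernel_CxiT_diag_le hd hξ hξ1 hN μ' μ x'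
    have h0 : 0 ≤ (ξ ^ 3)⁻¹ := by positivity
    nlinarith
  · have h := abs_d2Kernel_CxiT_le' hd hξ hξ1 hN hne μ' μ
    rw [max_one_supDist_of_ne hne]
    refine h.trans ?_
    have h0 : 0 ≤ ((ξ * (supDist x x' : ℝ)) ^ 3)⁻¹ * Real.exp (-(1 / 2 * (ξ * (supDist x x' : ℝ)))) := by positivity
    rw [mul_assoc]
    nlinarith

/-- **The diagonal kernel (∂^ξ_μC^ξ_T∂^{ξ*}_μ)(x,x′) of (3.9) at all sites** (r15's `dKernel ξ⁻¹ μ (CxiT ξ)` = `d2Kernel ξ⁻¹ μ μ (CxiT ξ)`):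
the same profile. [cite: Balaban1983Higgs3, (2.10) p.426] -/
theorem abs_dKernel_CxiT_profile (hd : P.d = 3) {ξ : ℝ} (hξ : 0 < ξ) (hξ1 : ξ ≤ 1) (hN : 1 ≤ ξ * (P.sitesPerDir j : ℝ))
    (μ : Fin P.d) (x x' : Site P j) :
    |dKernel ξ⁻¹ μ (CxiT ξ) x x'| ≤ (205875000 + 2 * (torusConst + 472501)) *
      (((ξ * max (1 : ℝ) (supDist x x' : ℝ)) ^ 3)⁻¹ * Real.exp (-(1 / 2 * (ξ * (supDist x x' : ℝ))))) := by
  rw [← d2Kernel_diag]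
  exact abs_d2Kernel_CxiT_profile hd hξ hξ1 hN μ μ x x'

/-- The all-sites profile in the regularised-distance form with the distance inside the exponential as well:
|(∂^ξ_{μ′}C^ξ_T∂^{ξ*}_μ)(x,x′)| ≤ (205875000 + 2(torusConst + 472501))·e^{½}·((ξ·max(1,supDist))³)⁻¹·e^{−½ξ·max(1,supDist)} (since
ξ·max(1,s) ≤ ξs + ξ ≤ ξs + 1). [cite: Balaban1983Higgs3, (2.10) p.426] -/
theorem abs_d2Kernel_CxiT_profile' (hd : P.d = 3) {ξ : ℝ} (hξ : 0 < ξ) (hξ1 : ξ ≤ 1) (hN : 1 ≤ ξ * (P.sitesPerDir j : ℝ))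
    (μ' μ : Fin P.d) (x x' : Site P j) :
    |d2Kernel ξ⁻¹ μ' μ (CxiT ξ) x x'| ≤ (205875000 + 2 * (torusConst + 472501)) * Real.exp (1 / 2) *
      (((ξ * max (1 : ℝ) (supDist x x' : ℝ)) ^ 3)⁻¹ * Real.exp (-(1 / 2 * (ξ * max (1 : ℝ) (supDist x x' : ℝ))))) := by
  refine (abs_d2Kernel_CxiT_profile hd hξ hξ1 hN μ' μ x x').trans ?_
  have hT := torusConst_nonneg
  have hm : max (1 : ℝ) (supDist x x' : ℝ) ≤ (supDist x x' : ℝ) + 1 := by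
    refine max_le ?_ (by linarith)
    have : (0 : ℝ) ≤ (supDist x x' : ℝ) := Nat.cast_nonneg _
    linarith
  have he : Real.exp (-(1 / 2 * (ξ * (supDist x x' : ℝ)))) ≤
      Real.exp (1 / 2) * Real.exp (-(1 / 2 * (ξ * max (1 : ℝ) (supDist x x' : ℝ)))) := by
    rw [← Real.exp_add]
    refine Real.exp_le_exp.mpr ?_
    have h1 : ξ * max (1 : ℝ) (supDist x x' : ℝ) ≤ ξ * (supDist x x' : ℝ) + 1 := by
      calc ξ * max (1 : ℝ) (supDist x x' : ℝ) ≤ ξ * ((supDist x x' : ℝ) + 1) := mul_le_mul_of_nonneg_left hm hξ.le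
        _ = ξ * (supDist x x' : ℝ) + ξ := by ring
        _ ≤ ξ * (supDist x x' : ℝ) + 1 := by linarith
    linarith
  have hI : 0 ≤ ((ξ * max (1 : ℝ) (supDist x x' : ℝ)) ^ 3)⁻¹ := by positivity
  calc (205875000 + 2 * (torusConst + 472501)) *
        (((ξ * max (1 : ℝ) (supDist x x' : ℝ)) ^ 3)⁻¹ * Real.exp (-(1 / 2 * (ξ * (supDist x x' : ℝ)))))
      ≤ (205875000 + 2 * (torusConst + 472501)) * (((ξ * max (1 : ℝ) (supDist x x' : ℝ)) ^ 3)⁻¹ *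
          (Real.exp (1 / 2) * Real.exp (-(1 / 2 * (ξ * max (1 : ℝ) (supDist x x' : ℝ)))))) := by
        gcongr
    _ = _ := by ring

end

end Literature.MathematicalPhysics.QuantumFieldTheory.Balaban1983to89.B3CxiTorusSecondDifferenceProfile
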